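import Summits.CriticalPhenomena.PercolationContinuityZ3.Theorems.PercBurnResprinkleVacantSetPercolatesCoarsePercolates
import HarnessLib

/-!
# Crux `PercBurnResprinkle.VacantSetPercolates` (stmt-CriticalPhenomena-7205), line `sheet-plane-product` — stub `stub_blocksPercolate` (ABSTRACT restatement)

Helper file for the crux skeleton of the line `sheet-plane-product`.  Proves exactly the registered
stub signature; lands with `--supports stmt-CriticalPhenomena-7205`.

The probabilistic step of the one-scale static renormalisation of the vacant proxy `quietSet R ω`
of `ℤ³` (Grimmett–Holroyd–Kozma 2014, §4): blocks are the cubes `P a + [0, n]³` indexed by the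
coarse plane `a ∈ ℤ²` (`P a = planeEmb 3 (n • a)`), a block is GOOD when its cube is quietly crossed
in the three coordinate directions and the tripled cube has no two quiet giants, and the coarse
lattice edge `{a, b}` of `ℤ²` is open iff both blocks are good.  Under `P_p` the coarse configuration
is a `5`-dependent bond process on `ℤ²` (hypothesis LOCALITY: the block events are determined by the
finite pair boxes `BFP a`, pairwise disjoint at coarse sup-distance `≥ 4`), whose edges are closed
with probability `≤ 2 · (3 P_p(Sheet) + P_p(TwoGiants))` (union bound; hypothesis MARGINALS
identifies the block marginals with the two origin events).  With both origin probabilities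
`≤ η / 8`, `η = η(5)` the constant of the tree's PROVED dependent-percolation input
`DuminilCopinSidoraviciusTassion2016_dependentPercolation_holds 5`, the push-forward percolates from
the coarse origin: this is `CoarsePercolates.pos_of_dependent` (sibling file
`PercBurnResprinkleVacantSetPercolatesCoarsePercolates.lean`), instantiated.  No definitions; helper
lemmas, written for abstract block events `Cross a i`, `TG a` and footprints `BFP a`, in the
sub-namespace `SPPBlocksPercolate`.
-/

noncomputable section

namespace Summit.CriticalPhenomena.PercolationContinuityZ3.Theorems

open MeasureTheory Set Literature.Probability.Percolation Literature.Probability.LatticeModels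

namespace SPPBlocksPercolate

/-! ### Locality of the coarse edges -/

/-- The coarse edge event `{ω | e ∈ BC ω}` ("`e` is a lattice edge of `ℤ²` and both its blocks are
good") is determined by the union of the footprints of the (two) members of `e`, a finite set of
pairs. [cite: GrimmettHolroydKozma2014, §4] -/
theorem determinedBy_edge (Cross : Site 2 → Fin 3 → Set (BondConfig (Site 3)))
    (TG : Site 2 → Set (BondConfig (Site 3))) (BFP : Site 2 → Set (Sym2 (Site 3)))
    (hLoc : ∀ a, (∀ i, DeterminedBy (Cross a i) (BFP a)) ∧ DeterminedBy (TG a) (BFP a) ∧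
      (BFP a).Finite)
    (e : Sym2 (Site 2)) :
    DeterminedBy {ω : BondConfig (Site 3) | e ∈ {e : Sym2 (Site 2) | e ∈ (zdGraph 2).edgeSet ∧
        ∀ a ∈ e, (∀ i : Fin 3, ω ∈ Cross a i) ∧ ω ∉ TG a}} (⋃ a ∈ e, BFP a) ∧
      (⋃ a ∈ e, BFP a).Finite := by
  refine ⟨?_, ?_⟩
  · rw [determinedBy_iff]
    intro ω ω' h
    simp only [mem_setOf_eq]
    refine and_congr_right fun _ => forall₂_congr fun a ha => ?_
    have hres : ω ∩ BFP a = ω' ∩ BFP a :=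
      inter_eq_inter_of_subset h (subset_iUnion₂ (s := fun a (_ : a ∈ e) => BFP a) a ha)
    exact and_congr (forall_congr' fun i => (determinedBy_iff _ _).1 ((hLoc a).1 i) ω ω' hres)
      (not_congr ((determinedBy_iff _ _).1 (hLoc a).2.1 ω ω' hres))
  · induction e using Sym2.ind with
    | _ x y =>
      refine ((hLoc x).2.2.union (hLoc y).2.2).subset (iUnion₂_subset fun a ha => ?_)
      rcases Sym2.mem_iff.1 ha with rfl | rfl
      · exact subset_union_left
      · exact subset_union_right

/-! ### Density of the coarse edges -/

/-- **Density of the coarse edges.** If every crossing event `Cross a i` fails with probability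
`≤ η₀` and every two-giants event `TG a` has probability `≤ η₀`, then a lattice edge `e = {a, b}` of
`ℤ²` is open in the coarse configuration (both blocks good) with probability `≥ 1 - 8 η₀`: union
bound over the `2 · (3 + 1)` bad events of the two blocks.
[cite: GrimmettHolroydKozma2014, §4 (proof of Thm. 5, (K1))] -/
theorem marginal (P : Measure (BondConfig (Site 3))) [IsProbabilityMeasure P]
    (Cross : Site 2 → Fin 3 → Set (BondConfig (Site 3))) (TG : Site 2 → Set (BondConfig (Site 3)))
    (hCm : ∀ a i, MeasurableSet (Cross a i)) (hTm : ∀ a, MeasurableSet (TG a))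
    {η₀ : ℝ} (hC : ∀ a i, P.real (Cross a i)ᶜ ≤ η₀) (hT : ∀ a, P.real (TG a) ≤ η₀)
    {e : Sym2 (Site 2)} (he : e ∈ (zdGraph 2).edgeSet) :
    1 - 8 * η₀ ≤ P.real {ω : BondConfig (Site 3) | e ∈ {e : Sym2 (Site 2) |
      e ∈ (zdGraph 2).edgeSet ∧ ∀ a ∈ e, (∀ i : Fin 3, ω ∈ Cross a i) ∧ ω ∉ TG a}} := by
  -- a block is bad with probability `≤ 4 η₀`
  have hG : ∀ a, P.real ((⋂ i, Cross a i) ∩ (TG a)ᶜ)ᶜ ≤ 4 * η₀ := by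
    intro a
    rw [compl_inter, compl_iInter, compl_compl]
    refine (measureReal_union_le _ _).trans ?_
    have h1 : P.real (⋃ i, (Cross a i)ᶜ) ≤ ∑ i, P.real (Cross a i)ᶜ :=
      measureReal_iUnion_fintype_le _
    rw [Fin.sum_univ_three] at h1
    linarith [hC a 0, hC a 1, hC a 2, hT a]
  have hGm : ∀ a, MeasurableSet ((⋂ i, Cross a i) ∩ (TG a)ᶜ) := fun a =>
    (MeasurableSet.iInter fun i => hCm a i).inter (hTm a).compl
  induction e using Sym2.ind with
  | _ a b =>
    -- both blocks good ⇒ the edge is open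
    have hsub : ((⋂ i, Cross a i) ∩ (TG a)ᶜ) ∩ ((⋂ i, Cross b i) ∩ (TG b)ᶜ) ⊆
        {ω : BondConfig (Site 3) | s(a, b) ∈ {e : Sym2 (Site 2) |
          e ∈ (zdGraph 2).edgeSet ∧ ∀ c ∈ e, (∀ i : Fin 3, ω ∈ Cross c i) ∧ ω ∉ TG c}} := by
      rintro ω ⟨⟨ha1, ha2⟩, hb1, hb2⟩
      refine ⟨he, fun c hc => ?_⟩
      rcases Sym2.mem_iff.1 hc with rfl | rfl
      · exact ⟨mem_iInter.1 ha1, ha2⟩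
      · exact ⟨mem_iInter.1 hb1, hb2⟩
    refine le_trans ?_ (measureReal_mono hsub (measure_ne_top _ _))
    have hc : P.real (((⋂ i, Cross a i) ∩ (TG a)ᶜ) ∩ ((⋂ i, Cross b i) ∩ (TG b)ᶜ))ᶜ ≤
        8 * η₀ := by
      rw [compl_inter]
      exact (measureReal_union_le _ _).trans (by linarith [hG a, hG b])
    rw [probReal_compl_eq_one_sub ((hGm a).inter (hGm b))] at hc
    linarith

/-! ### The renormalisation step -/

/-- **Dependent percolation of the block process.** If the block events `Cross a i`, `TG a` are
determined by finite footprints `BFP a`, pairwise disjoint at coarse sup-distance `≥ 4`, then the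
coarse configuration "lattice edge `{a, b}` open iff both blocks good" is, under `P_p`, a
`5`-dependent bond process on `ℤ²` (`CoarsePercolates.pos_of_dependent`); if moreover every
crossing fails with probability `≤ η / 8` and every two-giants event has probability `≤ η / 8`,
`η` the dependent-percolation constant of `ℤ²` at range `5`, its edges have density `≥ 1 - η`
(`marginal`) and the coarse origin percolates with positive probability.
[cite: GrimmettHolroydKozma2014, §4 (proof of Thm. 5, block argument)] -/
theorem pos (p : unitInterval) (Cross : Site 2 → Fin 3 → Set (BondConfig (Site 3)))
    (TG : Site 2 → Set (BondConfig (Site 3))) (BFP : Site 2 → Set (Sym2 (Site 3)))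
    (hLoc : ∀ a, (∀ i, DeterminedBy (Cross a i) (BFP a)) ∧ DeterminedBy (TG a) (BFP a) ∧
      (BFP a).Finite)
    (hdisj : ∀ a b : Site 2, (4 : ℤ) ≤ max |a 0 - b 0| |a 1 - b 1| → Disjoint (BFP a) (BFP b))
    {η : ℝ}
    (hD : ∀ (μ : Measure (BondConfig (Site 2))) [IsProbabilityMeasure μ],
      (∀ (F₁ F₂ : Finset (Sym2 (Site 2))),
        (∀ e₁ ∈ F₁, ∀ e₂ ∈ F₂, ∀ a ∈ e₁, ∀ b ∈ e₂,
          ((5 : ℕ) : ℤ) ≤ max |a 0 - b 0| |a 1 - b 1|) →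
        ∀ (A B : Set (BondConfig (Site 2))), DeterminedBy A (↑F₁ : Set (Sym2 (Site 2))) →
          DeterminedBy B (↑F₂ : Set (Sym2 (Site 2))) → MeasurableSet A → MeasurableSet B →
          μ (A ∩ B) = μ A * μ B) →
      (∀ e ∈ (zdGraph 2).edgeSet, 1 - η ≤ μ.real {ω | e ∈ ω}) →
      0 < μ.real (percolatesAt (0 : Site 2)))
    (hC : ∀ a i, (bondPercolation (zdGraph 3) p).real (Cross a i)ᶜ ≤ η / 8)
    (hT : ∀ a, (bondPercolation (zdGraph 3) p).real (TG a) ≤ η / 8) :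
    0 < (bondPercolation (zdGraph 3) p).real {ω | (openCluster
      {e : Sym2 (Site 2) | e ∈ (zdGraph 2).edgeSet ∧
        ∀ a ∈ e, (∀ i : Fin 3, ω ∈ Cross a i) ∧ ω ∉ TG a} (0 : Site 2)).Infinite} := by
  have h8 : (1 : ℝ) - η = 1 - 8 * (η / 8) := by ring
  have h45 : (4 : ℤ) ≤ ((5 : ℕ) : ℤ) := by norm_num
  refine CoarsePercolates.pos_of_dependent p
    (Φ := fun ω => {e : Sym2 (Site 2) | e ∈ (zdGraph 2).edgeSet ∧
      ∀ a ∈ e, (∀ i : Fin 3, ω ∈ Cross a i) ∧ ω ∉ TG a})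
    (FPT := fun e => ⋃ a ∈ e, BFP a) (determinedBy_edge Cross TG BFP hLoc)
    (fun e₁ e₂ hsep => Set.disjoint_iUnion₂_left.2 fun a ha => Set.disjoint_iUnion₂_right.2
      fun b hb => hdisj a b (h45.trans (hsep a ha b hb)))
    hD fun e he => h8.trans_le ?_
  exact marginal (bondPercolation (zdGraph 3) p) Cross TG
    (fun a i => CoarsePercolates.measurableSet_of_determinedBy_finite ((hLoc a).1 i) (hLoc a).2.2)
    (fun a => CoarsePercolates.measurableSet_of_determinedBy_finite (hLoc a).2.1 (hLoc a).2.2)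
    hC hT he

end SPPBlocksPercolate

/-- **Registered stub `stub_blocksPercolate`** (line `sheet-plane-product` of the crux
`VacantSetPercolates`), ABSTRACT form (the concrete block events are substituted by the skeleton):
for a universal `q > 0` (an eighth of the dependent-percolation constant of `ℤ²` at range `5`), for
any block events `Cross a i`, `TG a` determined by finite footprints `BFP a` that are disjoint at
coarse sup-distance `≥ 4`, if every crossing fails with probability `≤ q` and every two-giants event
has probability `≤ q`, then the coarse plane process "lattice edge `{a, b}` of `ℤ²` open iff both
blocks are good" percolates from the coarse origin with positive `P_p`-probability.  One-scale
static renormalisation: the push-forward is `5`-dependent with edge densities `≥ 1 - 8 q`, and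
`DuminilCopinSidoraviciusTassion2016_dependentPercolation_holds 5` applies (`SPPBlocksPercolate.pos`).
[cite: GrimmettHolroydKozma2014, §4 (proof of Thm. 5, block argument)] -/
theorem stub_blocksPercolate :
    ∃ q : ℝ, 0 < q ∧ ∀ (p : unitInterval) (Cross : Site 2 → Fin 3 → Set (BondConfig (Site 3)))
      (TG : Site 2 → Set (BondConfig (Site 3))) (BFP : Site 2 → Set (Sym2 (Site 3))),
      (∀ a, (∀ i, DeterminedBy (Cross a i) (BFP a)) ∧ DeterminedBy (TG a) (BFP a) ∧ (BFP a).Finite) →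
      (∀ a b : Site 2, (4 : ℤ) ≤ max |a 0 - b 0| |a 1 - b 1| → Disjoint (BFP a) (BFP b)) →
      (∀ a i, (bondPercolation (zdGraph 3) p).real (Cross a i)ᶜ ≤ q) →
      (∀ a, (bondPercolation (zdGraph 3) p).real (TG a) ≤ q) →
      0 < (bondPercolation (zdGraph 3) p).real {ω | (openCluster
        {e : Sym2 (Site 2) | e ∈ (zdGraph 2).edgeSet ∧ ∀ a ∈ e, (∀ i : Fin 3, ω ∈ Cross a i) ∧ ω ∉ TG a}
        (0 : Site 2)).Infinite} := by
  obtain ⟨η, hη, hD⟩ := DuminilCopinSidoraviciusTassion2016_dependentPercolation_holds 5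
  exact ⟨η / 8, by positivity, fun p Cross TG BFP hLoc hdisj hC hT =>
    SPPBlocksPercolate.pos p Cross TG BFP hLoc hdisj hD hC hT⟩

/-- **Concrete form** (the skeleton's `BlockLocality → BlockMarginals → BlocksPercolate`, objects
unfolded): LOCALITY → MARGINALS → for a universal `q > 0`, whenever `2R + 2 ≤ n` and the two origin
events — "no quiet crossing of the cube `[0, n]³`" and "two quiet giants in the tripled cube" — have
`P_p`-probability `≤ q`, the coarse plane process of good blocks `planeEmb 3 (n • a) + [0, n]³`
percolates from the coarse origin with positive `P_p`-probability.  Instantiation of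
`stub_blocksPercolate`. [cite: GrimmettHolroydKozma2014, §4 (proof of Thm. 5, block argument)] -/
theorem blocksPercolate_concrete :
    ((∀ (n R : ℕ) (a : Site 2),
      (∀ i : Fin 3, DeterminedBy
        {ω : BondConfig (Site 3) | ∃ x y : Site 3, x i = (planeEmb 3 ((n : ℤ) • a)) i ∧
          y i = (planeEmb 3 ((n : ℤ) • a)) i + (n : ℤ) ∧
          PathIn (zdGraph 3) (quietSet R ω ∩ {x : Site 3 | ∀ i, (planeEmb 3 ((n : ℤ) • a)) i ≤ x i ∧
            x i ≤ (planeEmb 3 ((n : ℤ) • a)) i + (n : ℤ)}) x y}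
        ({z : Site 3 | ∀ i, (planeEmb 3 ((n : ℤ) • a)) i - (n : ℤ) - (R : ℤ) ≤ z i ∧
          z i ≤ (planeEmb 3 ((n : ℤ) • a)) i + 2 * (n : ℤ) + (R : ℤ)}.sym2)) ∧
      DeterminedBy
        {ω : BondConfig (Site 3) | ∃ x y : Site 3,
          (∃ z : Site 3, PathIn (zdGraph 3) (quietSet R ω ∩ {x : Site 3 | ∀ i, (planeEmb 3 ((n : ℤ) • a)) i - (n : ℤ) ≤ x i ∧
            x i ≤ (planeEmb 3 ((n : ℤ) • a)) i + 2 * (n : ℤ)}) x z ∧ ∃ i : Fin 3, (n : ℤ) ≤ |z i - x i|) ∧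
          (∃ z : Site 3, PathIn (zdGraph 3) (quietSet R ω ∩ {x : Site 3 | ∀ i, (planeEmb 3 ((n : ℤ) • a)) i - (n : ℤ) ≤ x i ∧
            x i ≤ (planeEmb 3 ((n : ℤ) • a)) i + 2 * (n : ℤ)}) y z ∧ ∃ i : Fin 3, (n : ℤ) ≤ |z i - y i|) ∧
          ¬ PathIn (zdGraph 3) (quietSet R ω ∩ {x : Site 3 | ∀ i, (planeEmb 3 ((n : ℤ) • a)) i - (n : ℤ) ≤ x i ∧
            x i ≤ (planeEmb 3 ((n : ℤ) • a)) i + 2 * (n : ℤ)}) x y}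
        ({z : Site 3 | ∀ i, (planeEmb 3 ((n : ℤ) • a)) i - (n : ℤ) - (R : ℤ) ≤ z i ∧
          z i ≤ (planeEmb 3 ((n : ℤ) • a)) i + 2 * (n : ℤ) + (R : ℤ)}.sym2) ∧
      ({z : Site 3 | ∀ i, (planeEmb 3 ((n : ℤ) • a)) i - (n : ℤ) - (R : ℤ) ≤ z i ∧
          z i ≤ (planeEmb 3 ((n : ℤ) • a)) i + 2 * (n : ℤ) + (R : ℤ)}.sym2).Finite) ∧
    (∀ (n R : ℕ) (a b : Site 2), 2 * R + 2 ≤ n → (4 : ℤ) ≤ max |a 0 - b 0| |a 1 - b 1| →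
      Disjoint
        ({z : Site 3 | ∀ i, (planeEmb 3 ((n : ℤ) • a)) i - (n : ℤ) - (R : ℤ) ≤ z i ∧
          z i ≤ (planeEmb 3 ((n : ℤ) • a)) i + 2 * (n : ℤ) + (R : ℤ)}.sym2)
        ({z : Site 3 | ∀ i, (planeEmb 3 ((n : ℤ) • b)) i - (n : ℤ) - (R : ℤ) ≤ z i ∧
          z i ≤ (planeEmb 3 ((n : ℤ) • b)) i + 2 * (n : ℤ) + (R : ℤ)}.sym2))) →
    (∀ (p : unitInterval) (n R : ℕ) (a : Site 2),
      (∀ i : Fin 3, (bondPercolation (zdGraph 3) p).real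
        {ω : BondConfig (Site 3) | ∃ x y : Site 3, x i = (planeEmb 3 ((n : ℤ) • a)) i ∧
          y i = (planeEmb 3 ((n : ℤ) • a)) i + (n : ℤ) ∧
          PathIn (zdGraph 3) (quietSet R ω ∩ {x : Site 3 | ∀ i, (planeEmb 3 ((n : ℤ) • a)) i ≤ x i ∧
            x i ≤ (planeEmb 3 ((n : ℤ) • a)) i + (n : ℤ)}) x y}ᶜ =
        (bondPercolation (zdGraph 3) p).real
        {ω | ¬ ∃ x y : Site 3, x 0 = 0 ∧ y 0 = (n : ℤ) ∧
          PathIn (zdGraph 3) (quietSet R ω ∩ {x : Site 3 | ∀ i, 0 ≤ x i ∧ x i ≤ (n : ℤ)}) x y}) ∧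
      (bondPercolation (zdGraph 3) p).real
        {ω : BondConfig (Site 3) | ∃ x y : Site 3,
          (∃ z : Site 3, PathIn (zdGraph 3) (quietSet R ω ∩ {x : Site 3 | ∀ i, (planeEmb 3 ((n : ℤ) • a)) i - (n : ℤ) ≤ x i ∧
            x i ≤ (planeEmb 3 ((n : ℤ) • a)) i + 2 * (n : ℤ)}) x z ∧ ∃ i : Fin 3, (n : ℤ) ≤ |z i - x i|) ∧
          (∃ z : Site 3, PathIn (zdGraph 3) (quietSet R ω ∩ {x : Site 3 | ∀ i, (planeEmb 3 ((n : ℤ) • a)) i - (n : ℤ) ≤ x i ∧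
            x i ≤ (planeEmb 3 ((n : ℤ) • a)) i + 2 * (n : ℤ)}) y z ∧ ∃ i : Fin 3, (n : ℤ) ≤ |z i - y i|) ∧
          ¬ PathIn (zdGraph 3) (quietSet R ω ∩ {x : Site 3 | ∀ i, (planeEmb 3 ((n : ℤ) • a)) i - (n : ℤ) ≤ x i ∧
            x i ≤ (planeEmb 3 ((n : ℤ) • a)) i + 2 * (n : ℤ)}) x y} =
      (bondPercolation (zdGraph 3) p).real
        {ω : BondConfig (Site 3) | ∃ x y : Site 3,
          (∃ z : Site 3, PathIn (zdGraph 3) (quietSet R ω ∩ {x : Site 3 | ∀ i, -(n : ℤ) ≤ x i ∧ x i ≤ 2 * (n : ℤ)}) x z ∧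
            ∃ i : Fin 3, (n : ℤ) ≤ |z i - x i|) ∧
          (∃ z : Site 3, PathIn (zdGraph 3) (quietSet R ω ∩ {x : Site 3 | ∀ i, -(n : ℤ) ≤ x i ∧ x i ≤ 2 * (n : ℤ)}) y z ∧
            ∃ i : Fin 3, (n : ℤ) ≤ |z i - y i|) ∧
          ¬ PathIn (zdGraph 3) (quietSet R ω ∩ {x : Site 3 | ∀ i, -(n : ℤ) ≤ x i ∧ x i ≤ 2 * (n : ℤ)}) x y}) →
    ∃ q : ℝ, 0 < q ∧ ∀ (p : unitInterval) (n R : ℕ), 2 * R + 2 ≤ n →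
      (bondPercolation (zdGraph 3) p).real
        {ω | ¬ ∃ x y : Site 3, x 0 = 0 ∧ y 0 = (n : ℤ) ∧
          PathIn (zdGraph 3) (quietSet R ω ∩ {x : Site 3 | ∀ i, 0 ≤ x i ∧ x i ≤ (n : ℤ)}) x y} ≤ q →
      (bondPercolation (zdGraph 3) p).real
        {ω : BondConfig (Site 3) | ∃ x y : Site 3,
          (∃ z : Site 3, PathIn (zdGraph 3) (quietSet R ω ∩ {x : Site 3 | ∀ i, -(n : ℤ) ≤ x i ∧ x i ≤ 2 * (n : ℤ)}) x z ∧
            ∃ i : Fin 3, (n : ℤ) ≤ |z i - x i|) ∧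
          (∃ z : Site 3, PathIn (zdGraph 3) (quietSet R ω ∩ {x : Site 3 | ∀ i, -(n : ℤ) ≤ x i ∧ x i ≤ 2 * (n : ℤ)}) y z ∧
            ∃ i : Fin 3, (n : ℤ) ≤ |z i - y i|) ∧
          ¬ PathIn (zdGraph 3) (quietSet R ω ∩ {x : Site 3 | ∀ i, -(n : ℤ) ≤ x i ∧ x i ≤ 2 * (n : ℤ)}) x y} ≤ q →
      0 < (bondPercolation (zdGraph 3) p).real
        {ω | (openCluster
          {e : Sym2 (Site 2) | e ∈ (zdGraph 2).edgeSet ∧ ∀ a ∈ e,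
            (∀ i : Fin 3, ω ∈ {ω : BondConfig (Site 3) | ∃ x y : Site 3, x i = (planeEmb 3 ((n : ℤ) • a)) i ∧
              y i = (planeEmb 3 ((n : ℤ) • a)) i + (n : ℤ) ∧
              PathIn (zdGraph 3) (quietSet R ω ∩ {x : Site 3 | ∀ i, (planeEmb 3 ((n : ℤ) • a)) i ≤ x i ∧
                x i ≤ (planeEmb 3 ((n : ℤ) • a)) i + (n : ℤ)}) x y}) ∧
            ω ∉ {ω : BondConfig (Site 3) | ∃ x y : Site 3,
              (∃ z : Site 3, PathIn (zdGraph 3) (quietSet R ω ∩ {x : Site 3 | ∀ i, (planeEmb 3 ((n : ℤ) • a)) i - (n : ℤ) ≤ x i ∧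
                x i ≤ (planeEmb 3 ((n : ℤ) • a)) i + 2 * (n : ℤ)}) x z ∧ ∃ i : Fin 3, (n : ℤ) ≤ |z i - x i|) ∧
              (∃ z : Site 3, PathIn (zdGraph 3) (quietSet R ω ∩ {x : Site 3 | ∀ i, (planeEmb 3 ((n : ℤ) • a)) i - (n : ℤ) ≤ x i ∧
                x i ≤ (planeEmb 3 ((n : ℤ) • a)) i + 2 * (n : ℤ)}) y z ∧ ∃ i : Fin 3, (n : ℤ) ≤ |z i - y i|) ∧
              ¬ PathIn (zdGraph 3) (quietSet R ω ∩ {x : Site 3 | ∀ i, (planeEmb 3 ((n : ℤ) • a)) i - (n : ℤ) ≤ x i ∧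
                x i ≤ (planeEmb 3 ((n : ℤ) • a)) i + 2 * (n : ℤ)}) x y}}
          (0 : Site 2)).Infinite} := by
  intro hLoc hMarg
  obtain ⟨q, hq, H⟩ := stub_blocksPercolate
  refine ⟨q, hq, fun p n R hn hs hg => ?_⟩
  exact H p
    (fun a i => {ω : BondConfig (Site 3) | ∃ x y : Site 3, x i = (planeEmb 3 ((n : ℤ) • a)) i ∧
      y i = (planeEmb 3 ((n : ℤ) • a)) i + (n : ℤ) ∧
      PathIn (zdGraph 3) (quietSet R ω ∩ {x : Site 3 | ∀ i, (planeEmb 3 ((n : ℤ) • a)) i ≤ x i ∧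
        x i ≤ (planeEmb 3 ((n : ℤ) • a)) i + (n : ℤ)}) x y})
    (fun a => {ω : BondConfig (Site 3) | ∃ x y : Site 3,
      (∃ z : Site 3, PathIn (zdGraph 3) (quietSet R ω ∩ {x : Site 3 | ∀ i, (planeEmb 3 ((n : ℤ) • a)) i - (n : ℤ) ≤ x i ∧
        x i ≤ (planeEmb 3 ((n : ℤ) • a)) i + 2 * (n : ℤ)}) x z ∧ ∃ i : Fin 3, (n : ℤ) ≤ |z i - x i|) ∧
      (∃ z : Site 3, PathIn (zdGraph 3) (quietSet R ω ∩ {x : Site 3 | ∀ i, (planeEmb 3 ((n : ℤ) • a)) i - (n : ℤ) ≤ x i ∧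
        x i ≤ (planeEmb 3 ((n : ℤ) • a)) i + 2 * (n : ℤ)}) y z ∧ ∃ i : Fin 3, (n : ℤ) ≤ |z i - y i|) ∧
      ¬ PathIn (zdGraph 3) (quietSet R ω ∩ {x : Site 3 | ∀ i, (planeEmb 3 ((n : ℤ) • a)) i - (n : ℤ) ≤ x i ∧
        x i ≤ (planeEmb 3 ((n : ℤ) • a)) i + 2 * (n : ℤ)}) x y})
    (fun a => {z : Site 3 | ∀ i, (planeEmb 3 ((n : ℤ) • a)) i - (n : ℤ) - (R : ℤ) ≤ z i ∧
      z i ≤ (planeEmb 3 ((n : ℤ) • a)) i + 2 * (n : ℤ) + (R : ℤ)}.sym2)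
    (fun a => hLoc.1 n R a) (fun a b hab => hLoc.2 n R a b hn hab)
    (fun a i => ((hMarg p n R a).1 i).trans_le hs) (fun a => (hMarg p n R a).2.trans_le hg)

end Summit.CriticalPhenomena.PercolationContinuityZ3.Theorems

end
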